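import Summits.KontsevichZagierPeriods.KontsevichZagierPeriods.Theorems.RootDecompWalshStrataCutBall4Base

/-!
# Root decomposition on Walsh strata — part 105 (gen 13): the cap chart of the face-cut 4-ball

Crux `QuadricSignKernel` (item 25393), slice `d = 4`; notation of part 104.  Over the translated
planar base `T(ρ)` the cap `K_0(ρ)` is fibred by quarter discs of radius
`s = √(ρ − (1+y)² − y₁²)`, and the fibrewise scaling

  `Φ(y, y₁, u₀, u₁) = (1 + y, y₁, s·u₀, s·u₁)`,   `|det Φ'| = s² = ρ − (1+y)² − y₁²` (a POLYNOMIAL),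

maps the product `srcRep = tRep × [unit quarter disc, 1]` onto `[K_0(ρ), q]`: ONE rule-(2) move,
`of_srcRep_sub_of_capRep_mem_relations`.  By `KZ.of_mul_of` the source is `[tRep]·[quarter disc]`;
part 107 descends both factors (`tRep` to the Baker sector by rule (3) + `quadricBakerDescent_holds`,
the quarter disc to `[hq, 1]` by the landed disc/arc bridges).
[KontsevichZagier2001 §1.2 rule (2); BCR1998 §2.2]
-/

noncomputable section

open Literature.NumberTheory.Transcendental
open MeasureTheory Set
open MvPolynomial (aeval X C)
open Literature.ModelTheory.ExponentialFields (IsSemialgebraic isSemialgebraic_setOf_eval_pos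
  isSemialgebraic_setOf_eval_nonneg isSemialgebraic_setOf_eval_lt)
open Summit.KontsevichZagierPeriods.RootDecompWalshStrata.WalshSpanProof (cellRep cellRep_domain
  cellRep_integrand isSemialgebraic_cubeSet isBounded_cubeSet)
open Summit.KontsevichZagierPeriods.RootDecompWalshStrata.ConeSpecimen (discPoly aeval_discPoly)
open Summit.KontsevichZagierPeriods.RootDecompWalshStrata.ConicDescent (bddRep bddRep_domain bddRep_integrand
  lenRep)

namespace Summit.KontsevichZagierPeriods.RootDecompWalshStrata.CutBall4

variable {ρ : ℚ}

/-! #### The chart `Φ(y, y₁, u₀, u₁) = (1 + y, y₁, s·u₀, s·u₁)`, `s = √(ρ − (1+y)² − y₁²)` -/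

/-- The fibre radius squared, read in the source coordinates. -/
def gF (ρ : ℚ) (z : Fin 4 → ℝ) : ℝ := (ρ : ℝ) - (1 + z 0) ^ 2 - z 1 ^ 2

/-- The fibre radius `s = √g`. -/
def sF (ρ : ℚ) (z : Fin 4 → ℝ) : ℝ := √(gF ρ z)

/-- `s² = g` where `g ≥ 0`. [folklore] -/
theorem sF_sq {z : Fin 4 → ℝ} (hz : 0 ≤ gF ρ z) : sF ρ z ^ 2 = gF ρ z := Real.sq_sqrt hz

/-- `s > 0` where `g > 0`. [folklore] -/
theorem sF_pos {z : Fin 4 → ℝ} (hz : 0 < gF ρ z) : 0 < sF ρ z := Real.sqrt_pos.2 hz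

/-- The cap chart. -/
def phi (ρ : ℚ) (z : Fin 4 → ℝ) : Fin 4 → ℝ := ![1 + z 0, z 1, sF ρ z * z 2, sF ρ z * z 3]

/-- Component `0` of the chart: `x₀ = 1 + y`. [definition] -/
@[simp] theorem phi_zero (z : Fin 4 → ℝ) : phi ρ z 0 = 1 + z 0 := rfl

/-- Component `1` of the chart: `x₁ = y₁`. [definition] -/
@[simp] theorem phi_one (z : Fin 4 → ℝ) : phi ρ z 1 = z 1 := rfl

/-- Component `2` of the chart: `x₂ = s·u₀`. [definition] -/
@[simp] theorem phi_two (z : Fin 4 → ℝ) : phi ρ z 2 = sF ρ z * z 2 := rfl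

/-- Component `3` of the chart: `x₃ = s·u₁`. [definition] -/
@[simp] theorem phi_three (z : Fin 4 → ℝ) : phi ρ z 3 = sF ρ z * z 3 := rfl

/-- The Jacobian matrix of `Φ` (lower triangular; `∂s/∂y = −(1+y)/s`, `∂s/∂y₁ = −y₁/s`). -/
def phiMat (ρ : ℚ) (z : Fin 4 → ℝ) : Matrix (Fin 4) (Fin 4) ℝ :=
  !![1, 0, 0, 0;
     0, 1, 0, 0;
     -(1 + z 0) / sF ρ z * z 2, -(z 1) / sF ρ z * z 2, sF ρ z, 0;
     -(1 + z 0) / sF ρ z * z 3, -(z 1) / sF ρ z * z 3, 0, sF ρ z]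

/-- The derivative of `Φ` as a continuous linear map. -/
def phi' (ρ : ℚ) (z : Fin 4 → ℝ) : (Fin 4 → ℝ) →L[ℝ] (Fin 4 → ℝ) :=
  LinearMap.toContinuousLinearMap (Matrix.toLin' (phiMat ρ z))

/-- `Φ'(z)` acts by the Jacobian matrix. [calculus] -/
theorem phi'_apply (z v : Fin 4 → ℝ) (a : Fin 4) : phi' ρ z v a = ∑ b, phiMat ρ z a b * v b := by
  change Matrix.toLin' (phiMat ρ z) v a = _
  rw [Matrix.toLin'_apply]
  rfl

/-- `det Φ'(z) = s²`. [calculus] -/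
theorem phi'_det (z : Fin 4 → ℝ) : (phi' ρ z).det = sF ρ z ^ 2 := by
  change LinearMap.det (Matrix.toLin' (phiMat ρ z)) = _
  rw [LinearMap.det_toLin', phiMat, Matrix.det_succ_row_zero]
  simp [Fin.sum_univ_succ, Matrix.det_fin_three]
  ring

/-- `Φ` is differentiable where `g > 0`, with derivative `Φ'`. [calculus] -/
theorem hasFDerivAt_phi (z : Fin 4 → ℝ) (hz : 0 < gF ρ z) : HasFDerivAt (phi ρ) (phi' ρ z) z := by
  have hs0 : sF ρ z ≠ 0 := (sF_pos hz).ne'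
  have hπ0 : HasFDerivAt (fun y : Fin 4 → ℝ => y 0)
      (ContinuousLinearMap.proj (R := ℝ) (φ := fun _ : Fin 4 => ℝ) 0) z := hasFDerivAt_apply 0 z
  have hπ1 : HasFDerivAt (fun y : Fin 4 → ℝ => y 1)
      (ContinuousLinearMap.proj (R := ℝ) (φ := fun _ : Fin 4 => ℝ) 1) z := hasFDerivAt_apply 1 z
  have hA1 : HasDerivAt (fun t : ℝ => (1 + t) ^ 2) (2 * (1 + z 0)) (z 0) := by
    simpa using HasDerivAt.comp_const_add 1 (z 0) (hasDerivAt_pow 2 (1 + z 0))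
  have hA : HasFDerivAt (fun y : Fin 4 → ℝ => (1 + y 0) ^ 2)
      ((2 * (1 + z 0)) • ContinuousLinearMap.proj (R := ℝ) (φ := fun _ : Fin 4 => ℝ) 0) z :=
    HasDerivAt.comp_hasFDerivAt (h₂ := fun t : ℝ => (1 + t) ^ 2) z hA1 hπ0
  have hB1 : HasDerivAt (fun t : ℝ => t ^ 2) (2 * z 1) (z 1) := by
    simpa using hasDerivAt_pow 2 (z 1)
  have hB : HasFDerivAt (fun y : Fin 4 → ℝ => y 1 ^ 2)
      ((2 * z 1) • ContinuousLinearMap.proj (R := ℝ) (φ := fun _ : Fin 4 => ℝ) 1) z :=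
    HasDerivAt.comp_hasFDerivAt (h₂ := fun t : ℝ => t ^ 2) z hB1 hπ1
  have hg : HasFDerivAt (gF ρ)
      (0 - (2 * (1 + z 0)) • ContinuousLinearMap.proj (R := ℝ) (φ := fun _ : Fin 4 => ℝ) 0 -
        (2 * z 1) • ContinuousLinearMap.proj (R := ℝ) (φ := fun _ : Fin 4 => ℝ) 1) z :=
    ((hasFDerivAt_const (𝕜 := ℝ) (ρ : ℝ) z).sub hA).sub hB
  have hs : HasFDerivAt (sF ρ) ((1 / (2 * √(gF ρ z))) •
      (0 - (2 * (1 + z 0)) • ContinuousLinearMap.proj (R := ℝ) (φ := fun _ : Fin 4 => ℝ) 0 -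
        (2 * z 1) • ContinuousLinearMap.proj (R := ℝ) (φ := fun _ : Fin 4 => ℝ) 1)) z :=
    HasDerivAt.comp_hasFDerivAt (h₂ := Real.sqrt) z (Real.hasDerivAt_sqrt hz.ne') hg
  have hroot : √(gF ρ z) = sF ρ z := rfl
  rw [hroot] at hs
  have h0 : HasFDerivAt (fun y : Fin 4 → ℝ => phi ρ y 0)
      ((ContinuousLinearMap.proj 0).comp (phi' ρ z)) z := by
    have hf : (fun y : Fin 4 → ℝ => phi ρ y 0) = fun y => 1 + y 0 := funext phi_zero
    rw [hf]
    refine (hπ0.const_add 1).congr_fderiv (ContinuousLinearMap.ext fun v => ?_)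
    simp [phi'_apply, phiMat, Fin.sum_univ_four]
  have h1 : HasFDerivAt (fun y : Fin 4 → ℝ => phi ρ y 1)
      ((ContinuousLinearMap.proj 1).comp (phi' ρ z)) z := by
    have hf : (fun y : Fin 4 → ℝ => phi ρ y 1) = fun y => y 1 := funext phi_one
    rw [hf]
    refine hπ1.congr_fderiv (ContinuousLinearMap.ext fun v => ?_)
    simp [phi'_apply, phiMat, Fin.sum_univ_four]
  have h2 : HasFDerivAt (fun y : Fin 4 → ℝ => phi ρ y 2)
      ((ContinuousLinearMap.proj 2).comp (phi' ρ z)) z := by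
    have hf : (fun y : Fin 4 → ℝ => phi ρ y 2) = fun y => sF ρ y * y 2 := funext phi_two
    rw [hf]
    refine (hs.mul (hasFDerivAt_apply 2 z)).congr_fderiv (ContinuousLinearMap.ext fun v => ?_)
    simp [phi'_apply, phiMat, Fin.sum_univ_four]
    field_simp
    ring
  have h3 : HasFDerivAt (fun y : Fin 4 → ℝ => phi ρ y 3)
      ((ContinuousLinearMap.proj 3).comp (phi' ρ z)) z := by
    have hf : (fun y : Fin 4 → ℝ => phi ρ y 3) = fun y => sF ρ y * y 3 := funext phi_three
    rw [hf]
    refine (hs.mul (hasFDerivAt_apply 3 z)).congr_fderiv (ContinuousLinearMap.ext fun v => ?_)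
    simp [phi'_apply, phiMat, Fin.sum_univ_four]
    field_simp
    ring
  refine hasFDerivAt_pi'' fun a => ?_
  fin_cases a
  · exact h0
  · exact h1
  · exact h2
  · exact h3

/-- `Φ` is injective where `g > 0`. [calculus] -/
theorem injOn_phi : InjOn (phi ρ) {z | 0 < gF ρ z} := by
  intro x hx y _ hxy
  have e0 : 1 + x 0 = 1 + y 0 := by simpa using congrFun hxy 0
  have e1 : x 1 = y 1 := by simpa using congrFun hxy 1
  have e2 : sF ρ x * x 2 = sF ρ y * y 2 := by simpa using congrFun hxy 2
  have e3 : sF ρ x * x 3 = sF ρ y * y 3 := by simpa using congrFun hxy 3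
  have h0 : x 0 = y 0 := by linarith
  have hs : sF ρ x = sF ρ y := by simp only [sF, gF, h0, e1]
  have hs0 : sF ρ x ≠ 0 := (sF_pos hx).ne'
  rw [← hs] at e2 e3
  funext a
  fin_cases a
  · exact h0
  · exact e1
  · exact mul_left_cancel₀ hs0 e2
  · exact mul_left_cancel₀ hs0 e3

/-- `Φ` is a `ℚ`-semialgebraic map on every `ℚ`-semialgebraic set. [BCR1998 §2.2] -/
theorem isSemialgebraicMapOn_phi {S : Set (Fin 4 → ℝ)} (hS : IsSemialgebraic ℚ S) :
    IsSemialgebraicMapOn ℚ S (phi ρ) := by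
  have hsF : IsSemialgebraicFunOn ℚ S (sF ρ) :=
    (IsSemialgebraicFunOn.sqrt_holds (isSemialgebraicFunOn_aeval hS
      (C ρ - (1 + X 0) ^ 2 - X 1 ^ 2 : MvPolynomial (Fin 4) ℚ))).congr fun z _ => by
        simp only [sF, gF, map_sub, map_add, map_pow, map_one, MvPolynomial.aeval_X,
          MvPolynomial.aeval_C, eq_ratCast]
  refine IsSemialgebraicMapOn.of_forall hS fun j => ?_
  fin_cases j
  · exact (isSemialgebraicFunOn_aeval hS (1 + X 0 : MvPolynomial (Fin 4) ℚ)).congr fun z _ => by simp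
  · exact (isSemialgebraicFunOn_apply hS 1).congr fun z _ => by simp
  · exact (hsF.mul_holds (isSemialgebraicFunOn_apply hS 2)).congr fun z _ => by simp
  · exact (hsF.mul_holds (isSemialgebraicFunOn_apply hS 3)).congr fun z _ => by simp

/-- **`Φ` maps the source onto the cap `K_0(ρ)`** (inverse: `z = (x₀ − 1, x₁, x₂/s, x₃/s)`,
`s = √(ρ − x₀² − x₁²)`). [calculus] -/
theorem image_phi (q : ℚ) (h2 : ρ ≤ 2) : phi ρ '' (srcRep ρ q h2).domain = capSet ρ 0 := by
  ext x
  simp only [mem_image, mem_capSet]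
  constructor
  · rintro ⟨z, hz, rfl⟩
    rw [mem_src_iff] at hz
    obtain ⟨⟨h0, h1, hr⟩, ⟨⟨h2a, h2b⟩, ⟨h3a, h3b⟩⟩, hd⟩ := hz
    have hg : 0 < gF ρ z := by rw [gF]; linarith
    have hs := sF_pos hg
    have hsq := sF_sq hg.le
    refine ⟨fun j => ?_, by simp; linarith, ?_⟩
    · fin_cases j
      · simp; linarith
      · simpa using h1
      · simpa using mul_pos hs h2a
      · simpa using mul_pos hs h3a
    · rw [nsq, phi_zero, phi_one, phi_two, phi_three]
      rw [gF] at hsq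
      nlinarith [mul_pos hs h2a, mul_pos hs h3a]
  · rintro ⟨hpos, hx0, hn⟩
    rw [nsq] at hn
    have h1 := hpos 1; have hx2 := hpos 2; have hx3 := hpos 3
    have hg : 0 < (ρ : ℝ) - x 0 ^ 2 - x 1 ^ 2 := by nlinarith
    set s : ℝ := √((ρ : ℝ) - x 0 ^ 2 - x 1 ^ 2) with hs_def
    have hs : 0 < s := Real.sqrt_pos.2 hg
    have hsq : s ^ 2 = (ρ : ℝ) - x 0 ^ 2 - x 1 ^ 2 := Real.sq_sqrt hg.le
    have hsF : ∀ z : Fin 4 → ℝ, z 0 = x 0 - 1 → z 1 = x 1 → sF ρ z = s := by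
      intro z hz0 hz1
      rw [sF, gF, hz0, hz1, hs_def]
      ring_nf
    refine ⟨![x 0 - 1, x 1, x 2 / s, x 3 / s], ?_, ?_⟩
    · rw [mem_src_iff]
      simp only [Matrix.cons_val_zero, Matrix.cons_val_one, Matrix.cons_val]
      have h2s : x 2 < s := by nlinarith
      have h3s : x 3 < s := by nlinarith
      refine ⟨⟨by linarith, h1, by nlinarith⟩, ⟨⟨div_pos hx2 hs, (div_lt_one hs).2 h2s⟩,
        ⟨div_pos hx3 hs, (div_lt_one hs).2 h3s⟩⟩, ?_⟩
      rw [div_pow, div_pow, ← add_div, div_lt_one (by positivity), hsq]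
      linarith
    · have hsz : sF ρ ![x 0 - 1, x 1, x 2 / s, x 3 / s] = s := hsF _ rfl rfl
      funext a
      fin_cases a
      · simp
      · simp
      · simp only [Fin.reduceFinMk, phi_two, Matrix.cons_val, hsz]
        field_simp
      · simp only [Fin.reduceFinMk, phi_three, Matrix.cons_val, hsz]
        field_simp

/-! #### Move (2): `[tRep × quarter disc] − [K_0(ρ), q]` is a change of variables along `Φ` -/

/-- **Move (2), the cap chart:** `[tRep ρ q × unit quarter disc] − [K_0(ρ), q] ∈ KZ.relations`
(`|det Φ'| = s² = ρ − (1+y)² − y₁²`, matching the source weight `q·(ρ − (1+y)² − y₁²)·1`).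
[KontsevichZagier2001 §1.2 rule (2)] -/
theorem of_srcRep_sub_of_capRep_mem_relations (q : ℚ) (h2 : ρ ≤ 2) :
    KZ.of (srcRep ρ q h2) - KZ.of (capRep ρ q h2 0) ∈ KZ.relations := by
  have hgdom : ∀ z ∈ (srcRep ρ q h2).domain, 0 < gF ρ z := fun z hz => by
    rw [mem_src_iff] at hz
    rw [gF]; linarith [hz.1.2.2]
  refine KZ.changeOfVariablesRel_subset_relations
    ⟨2 + 2, srcRep ρ q h2, capRep ρ q h2 0, phi ρ, phi' ρ,
      isSemialgebraicMapOn_phi (srcRep ρ q h2).isSemialgebraic_domain,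
      fun z hz => (hasFDerivAt_phi z (hgdom z hz)).hasFDerivWithinAt,
      injOn_phi.mono hgdom, ?_, fun z hz => ?_, rfl⟩
  · exact (capRep_domain q h2 0).trans (image_phi q h2).symm
  · rw [srcRep_integrand, capRep_integrand, phi'_det, abs_of_nonneg (sq_nonneg _),
      sF_sq (hgdom z hz).le, gF]

end Summit.KontsevichZagierPeriods.RootDecompWalshStrata.CutBall4

end
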